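import Literature.Computability.FineGrained.BKGadgetStructure
import Literature.Computability.FineGrained.BKGadgetWindow
import HarnessLib

/-!
# The Bringmann–Künnemann alignment gadget: Claim 5.9 in the frame `0^{γ₂} G(xᵢ) 0^{γ₂}`

K. Bringmann, M. Künnemann, *Quadratic conditional lower bounds for string problems and dynamic
time warping*, FOCS 2015 (arXiv:1502.01063), §5.2, Claim 5.9, for `c_subst = 1` (`ρ = 2`,
`β = 4/5`, `γ₁ = 20(ℓₓ+ℓ_y)`), in the coordinates of the frame `S = 0^{γ₂} G(xᵢ) 0^{γ₂}` in which
a short piece `x(G(yⱼ))` of `x` lives (`Params.claim59_frame`): for every substring `p = S[s..e)`,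
either

* (the case `(*)` of the printed proof) `editDist p G(yⱼ) ≥ γ₁/4 = 5(ℓₓ+ℓ_y)`, or
* (the aligned case) both ends of `p` are within `γ₁/2` of the ends of `G(xᵢ)` — so `p` contains
  `xᵢ` and `j` is aligned with `i` — and
  `editDist p G(yⱼ) ≥ editDist xᵢ yⱼ + Δ_L + Δ_R`, where `Δ_L = |s - γ₂|` and
  `Δ_R = |e - (γ₂+γ₄)|` are the distances of the ends of `p` from the ends of `G(xᵢ)`
  (print: `≥ editDist(xᵢ,yⱼ) + Δ_L(-2ρ) + Δ_R(2ρ)`).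

Proof as printed, with the simplifications available for `c_subst = 1`: split `p` along the nine
blocks `z₋₄ ⋯ z₄ = 1^{γ₁} 0^{γ₁} 1^{γ₁} 0^{γ₁} yⱼ 0^{γ₁} 1^{γ₁} 0^{γ₁} 1^{γ₁}` of `G(yⱼ)` (Fact 5.7,
`Cryptography.exists_boundaries_editDist_le`); if one of the four pieces facing a block `1^{γ₁}`
costs `≥ γ₁/4` we are in the first case; otherwise each of them is shorter than `5γ₁/4` and has
more than `3γ₁/4` ones, hence is anchored at the corresponding block `1^{γ₁}` of `G(xᵢ)`
(`Params.exists_anchor`, `Params.anchor_lt_anchor`, `Params.anchors_eq`), and the five estimates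
`Params.dist_left_le`, `Params.dist_mid_left_le`, Fact 5.5(3) for the middle piece
(`Cryptography.editDist_drop_take_le`), `Params.dist_mid_right_le`, `Params.dist_right_le` add up
to the second case.
-/

namespace Literature.Computability.FineGrained

open Cryptography Finset

namespace BKGadget

namespace Params

variable (P : Params)

/-- The frame around `xᵢ`: `0^{γ₂} G(xᵢ) 0^{γ₂} = (0^{γ₂} 1^γ 0^γ 1^γ 0^γ) xᵢ (0^γ 1^γ 0^γ 1^γ 0^{γ₂})`, the
first part of length `γ₂ + 4γ₁`. [cite: BringmannKunnemannFOCS2015, Lemma 5.3] -/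
theorem frame_eq (xi : List Bool) :
    zeros P.γ₂ ++ P.guard xi ++ zeros P.γ₂ =
      (zeros P.γ₂ ++ ones P.γ₁ ++ zeros P.γ₁ ++ ones P.γ₁ ++ zeros P.γ₁) ++ xi ++
        (zeros P.γ₁ ++ ones P.γ₁ ++ zeros P.γ₁ ++ ones P.γ₁ ++ zeros P.γ₂) := by
  simp [guard, List.append_assoc]

/-- `xᵢ` is the substring `S[γ₂+4γ₁ .. γ₂+4γ₁+ℓₓ)` of its frame `S`. [cite: BringmannKunnemannFOCS2015, Lemma 5.3] -/
theorem drop_take_frame_eq_self (xi : List Bool) (hxi : xi.length = P.ℓx) :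
    ((zeros P.γ₂ ++ P.guard xi ++ zeros P.γ₂).take (P.γ₂ + 4 * P.γ₁ + P.ℓx)).drop (P.γ₂ + 4 * P.γ₁) =
      xi := by
  have hlenA : (zeros P.γ₂ ++ ones P.γ₁ ++ zeros P.γ₁ ++ ones P.γ₁ ++ zeros P.γ₁).length =
      P.γ₂ + 4 * P.γ₁ := by
    simp only [List.length_append, length_ones, length_zeros]; ring
  have h := drop_take_append_middle (zeros P.γ₂ ++ ones P.γ₁ ++ zeros P.γ₁ ++ ones P.γ₁ ++ zeros P.γ₁)
    xi (zeros P.γ₁ ++ ones P.γ₁ ++ zeros P.γ₁ ++ ones P.γ₁ ++ zeros P.γ₂) (u := 0) (v := P.ℓx)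
    (by rw [hxi])
  rw [← P.frame_eq xi, hlenA, Nat.add_zero, List.drop_zero,
    List.take_of_length_le (l := xi) (by rw [hxi])] at h
  exact h

/-- **Claim 5.9 in the frame** (Bringmann–Künnemann, FOCS 2015, `c_subst = 1`): for a substring
`p = S[s..e)` of `S = 0^{γ₂} G(xᵢ) 0^{γ₂}` (`|xᵢ| = ℓₓ`) and any `yⱼ`, either
`editDist p G(yⱼ) ≥ γ₁/4 = 5(ℓₓ+ℓ_y)` (case `(*)`), or the two ends of `p` are within
`γ₁/2 = 10(ℓₓ+ℓ_y)` of the two ends `γ₂`, `γ₂+γ₄` of `G(xᵢ)` and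
`editDist p G(yⱼ) ≥ editDist xᵢ yⱼ + |s - γ₂| + |e - (γ₂+γ₄)|` (the aligned case:
`≥ editDist(xᵢ,yⱼ) + Δ_L(-2ρ) + Δ_R(2ρ)`). [cite: BringmannKunnemannFOCS2015, Claim 5.9] -/
theorem claim59_frame (xi y : List Bool) (hxi : xi.length = P.ℓx) {s e : ℕ} (hse : s ≤ e)
    (he : e ≤ 2 * P.γ₂ + P.γ₄) :
    5 * (P.ℓx + P.ℓy) ≤
        editDist (((zeros P.γ₂ ++ P.guard xi ++ zeros P.γ₂).take e).drop s) (P.guard y) ∨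
      ((s - P.γ₂) + (P.γ₂ - s) ≤ 10 * (P.ℓx + P.ℓy) ∧
        (e - (P.γ₂ + P.γ₄)) + (P.γ₂ + P.γ₄ - e) ≤ 10 * (P.ℓx + P.ℓy) ∧
        editDist xi y + ((s - P.γ₂) + (P.γ₂ - s)) + ((e - (P.γ₂ + P.γ₄)) + (P.γ₂ + P.γ₄ - e)) ≤
          editDist (((zeros P.γ₂ ++ P.guard xi ++ zeros P.γ₂).take e).drop s) (P.guard y)) := by
  obtain ⟨S, hS⟩ : ∃ S, S = zeros P.γ₂ ++ P.guard xi ++ zeros P.γ₂ := ⟨_, rfl⟩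
  rw [← hS]
  have hγ : P.γ₁ = 20 * (P.ℓx + P.ℓy) := rfl
  have hγ₄ : P.γ₄ = 8 * P.γ₁ + P.ℓx := rfl
  have hSlen : S.length = 2 * P.γ₂ + P.γ₄ := by
    rw [hS]; simp only [List.length_append, length_zeros, length_guard, hxi, hγ₄]; ring
  have hxiS : (S.take (P.γ₂ + 4 * P.γ₁ + P.ℓx)).drop (P.γ₂ + 4 * P.γ₁) = xi := by
    rw [hS]; exact P.drop_take_frame_eq_self xi hxi
  set p := (S.take e).drop s with hp
  have hplen : p.length = e - s := by rw [hp, length_drop_take', hSlen, min_eq_left he]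
  -- `S = S[0..s) p S[e..)`, so the pieces of `p` are substrings of `S`
  have hSsplit : S.take s ++ p ++ S.drop e = S := by
    have h1 : (S.take e).take s = S.take s := by rw [List.take_take, min_eq_left hse]
    rw [hp, ← h1, List.take_append_drop, List.take_append_drop]
  have hslen : (S.take s).length = s := by rw [List.length_take, hSlen]; omega
  have hpiece : ∀ u v, v ≤ e - s → (p.take v).drop u = (S.take (s + v)).drop (s + u) := by
    intro u v hv
    have h := drop_take_append_middle (S.take s) p (S.drop e) (u := u) (v := v)
      (by rw [hplen]; exact hv)
    rw [hSsplit, hslen] at h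
    exact h.symm
  -- split `p` along the nine blocks of `G(y)` (Fact 5.7)
  obtain ⟨t, ht0, ht9, hmono, htle, hsum⟩ := exists_boundaries_editDist_le
    [ones P.γ₁, zeros P.γ₁, ones P.γ₁, zeros P.γ₁, y, zeros P.γ₁, ones P.γ₁, zeros P.γ₁, ones P.γ₁]
    (by simp) p
  have hflat : [ones P.γ₁, zeros P.γ₁, ones P.γ₁, zeros P.γ₁, y, zeros P.γ₁, ones P.γ₁, zeros P.γ₁,
      ones P.γ₁].flatten = P.guard y := by
    simp [guard, List.append_assoc]
  rw [hflat] at hsum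
  simp only [List.length_cons, List.length_nil, Nat.reduceAdd] at ht9 hsum
  rw [hplen] at ht9 htle
  have hst0 : s + t 0 = s := by rw [ht0, Nat.add_zero]
  have hst9 : s + t 9 = e := by rw [ht9 9 le_rfl]; omega
  simp only [sum_range_succ, sum_range_zero, zero_add, List.getD_eq_getElem?_getD,
    List.getElem?_cons_succ, List.getElem?_cons_zero, Option.getD_some] at hsum
  rw [hpiece (t 0) (t 1) (htle 1), hpiece (t 1) (t 2) (htle 2), hpiece (t 2) (t 3) (htle 3),
    hpiece (t 3) (t 4) (htle 4), hpiece (t 4) (t 5) (htle 5), hpiece (t 5) (t 6) (htle 6),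
    hpiece (t 6) (t 7) (htle 7), hpiece (t 7) (t 8) (htle 8), hpiece (t 8) (t 9) (htle 9),
    hst0, hst9] at hsum
  -- bookkeeping for the pieces `S[s + t k .. s + t (k+1))`
  have hq_len : ∀ u v, u ≤ v → v ≤ e → ((S.take v).drop u).length = v - u := by
    intro u v huv hv; rw [length_drop_take', hSlen]; omega
  have hq_cnt : ∀ u v, u ≤ v →
      (S.take u).count true + ((S.take v).drop u).count true = (S.take v).count true :=
    fun u v huv => count_take_add_count_drop_take S true huv
  have hones_a : ∀ q : List Bool, P.γ₁ ≤ editDist q (ones P.γ₁) + q.count true :=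
    fun q => le_editDist_replicate_add_count q true P.γ₁
  have hones_b : ∀ q : List Bool, q.length ≤ editDist q (ones P.γ₁) + q.count true :=
    fun q => length_le_editDist_replicate_add_count q true P.γ₁
  have hones_l : ∀ q : List Bool, q.length ≤ editDist q (ones P.γ₁) + P.γ₁ := fun q => by
    simpa using length_le_editDist_add_length_right q (ones P.γ₁)
  have hzeros_a : ∀ q : List Bool, q.length ≤ editDist q (zeros P.γ₁) + P.γ₁ := fun q => by
    simpa using length_le_editDist_add_length_right q (zeros P.γ₁)
  have hzeros_b : ∀ q : List Bool, P.γ₁ ≤ editDist q (zeros P.γ₁) + q.length := fun q => by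
    simpa using length_le_editDist_add_length_left q (zeros P.γ₁)
  have he1 : s + t 1 ≤ e := by have := htle 1; omega
  have he3 : s + t 3 ≤ e := by have := htle 3; omega
  have he4 : s + t 4 ≤ e := by have := htle 4; omega
  have he6 : s + t 6 ≤ e := by have := htle 6; omega
  have he7 : s + t 7 ≤ e := by have := htle 7; omega
  -- orderings of the cut points used below
  have hm0 : s ≤ s + t 1 := Nat.le_add_right _ _
  have hm1 : s + t 1 ≤ s + t 2 := Nat.add_le_add_left (hmono (show (1 : ℕ) ≤ 2 by norm_num)) s
  have hm2 : s + t 2 ≤ s + t 3 := Nat.add_le_add_left (hmono (show (2 : ℕ) ≤ 3 by norm_num)) s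
  have hm3 : s + t 3 ≤ s + t 4 := Nat.add_le_add_left (hmono (show (3 : ℕ) ≤ 4 by norm_num)) s
  have hm4 : s + t 4 ≤ s + t 5 := Nat.add_le_add_left (hmono (show (4 : ℕ) ≤ 5 by norm_num)) s
  have hm5 : s + t 5 ≤ s + t 6 := Nat.add_le_add_left (hmono (show (5 : ℕ) ≤ 6 by norm_num)) s
  have hm6 : s + t 6 ≤ s + t 7 := Nat.add_le_add_left (hmono (show (6 : ℕ) ≤ 7 by norm_num)) s
  have hm7 : s + t 7 ≤ s + t 8 := Nat.add_le_add_left (hmono (show (7 : ℕ) ≤ 8 by norm_num)) s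
  have hm8 : s + t 8 ≤ e := by have := htle 8; omega
  -- the four pieces facing blocks of ones, and the two facing `z₋₁`, `z₁`
  have h0a := hones_a ((S.take (s + t 1)).drop s)
  have h0b := hones_b ((S.take (s + t 1)).drop s)
  have h0z := hones_l ((S.take (s + t 1)).drop s)
  have h0l := hq_len s (s + t 1) hm0 he1
  have h0c := hq_cnt s (s + t 1) hm0
  have h2a := hones_a ((S.take (s + t 3)).drop (s + t 2))
  have h2b := hones_b ((S.take (s + t 3)).drop (s + t 2))
  have h2z := hones_l ((S.take (s + t 3)).drop (s + t 2))
  have h2l := hq_len (s + t 2) (s + t 3) hm2 he3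
  have h2c := hq_cnt (s + t 2) (s + t 3) hm2
  have h3a := hzeros_a ((S.take (s + t 4)).drop (s + t 3))
  have h3b := hzeros_b ((S.take (s + t 4)).drop (s + t 3))
  have h3l := hq_len (s + t 3) (s + t 4) hm3 he4
  have h5a := hzeros_a ((S.take (s + t 6)).drop (s + t 5))
  have h5b := hzeros_b ((S.take (s + t 6)).drop (s + t 5))
  have h5l := hq_len (s + t 5) (s + t 6) hm5 he6
  have h6a := hones_a ((S.take (s + t 7)).drop (s + t 6))
  have h6b := hones_b ((S.take (s + t 7)).drop (s + t 6))
  have h6z := hones_l ((S.take (s + t 7)).drop (s + t 6))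
  have h6l := hq_len (s + t 6) (s + t 7) hm6 he7
  have h6c := hq_cnt (s + t 6) (s + t 7) hm6
  have h8a := hones_a ((S.take e).drop (s + t 8))
  have h8b := hones_b ((S.take e).drop (s + t 8))
  have h8z := hones_l ((S.take e).drop (s + t 8))
  have h8l := hq_len (s + t 8) e hm8 le_rfl
  have h8c := hq_cnt (s + t 8) e hm8
  -- the middle piece faces `y`: Fact 5.5(3) against `xᵢ = S[γ₂+4γ₁ .. γ₂+4γ₁+ℓₓ)`
  have h4 := editDist_drop_take_le S y (s + t 4) (s + t 5) (P.γ₂ + 4 * P.γ₁) (P.γ₂ + 4 * P.γ₁ + P.ℓx)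
  rw [hxiS] at h4
  clear hq_len hq_cnt hones_a hones_b hones_l hzeros_a hzeros_b hpiece hSsplit hslen hflat htle ht9
    hmono
  by_cases hA : 5 * (P.ℓx + P.ℓy) ≤ editDist ((S.take (s + t 1)).drop s) (ones P.γ₁) ∨
      5 * (P.ℓx + P.ℓy) ≤ editDist ((S.take (s + t 3)).drop (s + t 2)) (ones P.γ₁) ∨
      5 * (P.ℓx + P.ℓy) ≤ editDist ((S.take (s + t 7)).drop (s + t 6)) (ones P.γ₁) ∨
      5 * (P.ℓx + P.ℓy) ≤ editDist ((S.take e).drop (s + t 8)) (ones P.γ₁)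
  · -- case `(*)`
    left; omega
  · right
    push Not at hA
    obtain ⟨hA0, hA2, hA6, hA8⟩ := hA
    -- the four pieces facing blocks of ones are short with many ones …
    have hw0a : s + t 1 < s + 5 * (5 * (P.ℓx + P.ℓy)) := by omega
    have hw0b : (S.take s).count true + 3 * (5 * (P.ℓx + P.ℓy)) < (S.take (s + t 1)).count true := by
      omega
    have hw2a : s + t 3 < s + t 2 + 5 * (5 * (P.ℓx + P.ℓy)) := by omega
    have hw2b : (S.take (s + t 2)).count true + 3 * (5 * (P.ℓx + P.ℓy)) <
        (S.take (s + t 3)).count true := by omega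
    have hw6a : s + t 7 < s + t 6 + 5 * (5 * (P.ℓx + P.ℓy)) := by omega
    have hw6b : (S.take (s + t 6)).count true + 3 * (5 * (P.ℓx + P.ℓy)) <
        (S.take (s + t 7)).count true := by omega
    have hw8a : e < s + t 8 + 5 * (5 * (P.ℓx + P.ℓy)) := by omega
    have hw8b : (S.take (s + t 8)).count true + 3 * (5 * (P.ℓx + P.ℓy)) <
        (S.take e).count true := by omega
    -- … the inputs of the five estimates …
    have hE0 : P.γ₁ ≤ editDist ((S.take (s + t 1)).drop s) (ones P.γ₁) +
        ((S.take (s + t 1)).count true - (S.take s).count true) := by omega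
    have hE0' : s + t 1 - s ≤ editDist ((S.take (s + t 1)).drop s) (ones P.γ₁) +
        ((S.take (s + t 1)).count true - (S.take s).count true) := by omega
    have hE2 : P.γ₁ ≤ editDist ((S.take (s + t 3)).drop (s + t 2)) (ones P.γ₁) +
        ((S.take (s + t 3)).count true - (S.take (s + t 2)).count true) := by omega
    have hE2' : s + t 3 - (s + t 2) ≤ editDist ((S.take (s + t 3)).drop (s + t 2)) (ones P.γ₁) +
        ((S.take (s + t 3)).count true - (S.take (s + t 2)).count true) := by omega
    have hE3 : s + t 4 - (s + t 3) ≤ editDist ((S.take (s + t 4)).drop (s + t 3)) (zeros P.γ₁) + P.γ₁ := by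
      omega
    have hE3' : P.γ₁ ≤ editDist ((S.take (s + t 4)).drop (s + t 3)) (zeros P.γ₁) + (s + t 4 - (s + t 3)) := by
      omega
    have hE5 : s + t 6 - (s + t 5) ≤ editDist ((S.take (s + t 6)).drop (s + t 5)) (zeros P.γ₁) + P.γ₁ := by
      omega
    have hE5' : P.γ₁ ≤ editDist ((S.take (s + t 6)).drop (s + t 5)) (zeros P.γ₁) + (s + t 6 - (s + t 5)) := by
      omega
    have hE6 : P.γ₁ ≤ editDist ((S.take (s + t 7)).drop (s + t 6)) (ones P.γ₁) +
        ((S.take (s + t 7)).count true - (S.take (s + t 6)).count true) := by omega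
    have hE6' : s + t 7 - (s + t 6) ≤ editDist ((S.take (s + t 7)).drop (s + t 6)) (ones P.γ₁) +
        ((S.take (s + t 7)).count true - (S.take (s + t 6)).count true) := by omega
    have hE8 : P.γ₁ ≤ editDist ((S.take e).drop (s + t 8)) (ones P.γ₁) +
        ((S.take e).count true - (S.take (s + t 8)).count true) := by omega
    have hE8' : e - (s + t 8) ≤ editDist ((S.take e).drop (s + t 8)) (ones P.γ₁) +
        ((S.take e).count true - (S.take (s + t 8)).count true) := by omega
    clear h0a h0b h0z h0l h0c h2a h2b h2z h2l h2c h3a h3b h3l h5a h5b h5l h6a h6b h6z h6l h6c h8a h8b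
      h8z h8l h8c hA0 hA2 hA6 hA8
    -- … so they are anchored at the four blocks of ones of `G(xᵢ)`, in order
    have W0 := P.exists_anchor xi hxi (u := s) (v := s + t 1) hm0
    have W2 := P.exists_anchor xi hxi (u := s + t 2) (v := s + t 3) hm2
    have W6 := P.exists_anchor xi hxi (u := s + t 6) (v := s + t 7) hm6
    have W8 := P.exists_anchor xi hxi (u := s + t 8) (v := e) hm8
    rw [← hS] at W0 W2 W6 W8
    obtain ⟨B₀, hB₀, hB₀l, hB₀l', hB₀r, hB₀r', hB₀o⟩ := W0 hw0a hw0b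
    obtain ⟨B₂, hB₂, hB₂l, hB₂l', hB₂r, hB₂r', hB₂o⟩ := W2 hw2a hw2b
    obtain ⟨B₆, hB₆, hB₆l, hB₆l', hB₆r, hB₆r', hB₆o⟩ := W6 hw6a hw6b
    obtain ⟨B₈, hB₈, hB₈l, hB₈l', hB₈r, hB₈r', hB₈o⟩ := W8 hw8a hw8b
    clear W0 W2 W6 W8 hw0a hw0b hw2a hw2b hw6a hw6b hw8a hw8b
    have h02 := P.anchor_lt_anchor hB₀o hB₂o hm1
    have h26 := P.anchor_lt_anchor hB₂o hB₆o (hm3.trans (hm4.trans hm5))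
    have h68 := P.anchor_lt_anchor hB₆o hB₈o hm7
    clear hB₀o hB₂o hB₆o hB₈o
    obtain ⟨rfl, rfl, rfl, rfl⟩ := P.anchors_eq hB₀ hB₂ hB₆ hB₈ h02 h26 h68
    clear hB₀ hB₂ hB₆ hB₈ h02 h26 h68
    -- the five estimates
    have D0 := P.dist_left_le xi hxi (T₀ := s) (T₁ := s + t 1)
      (E := editDist ((S.take (s + t 1)).drop s) (ones P.γ₁)) hm0 ⟨hB₀l', hB₀l⟩ ⟨hB₀r', hB₀r⟩
    have D4 := P.dist_mid_left_le xi hxi (T₂ := s + t 2) (T₃ := s + t 3) (T₄ := s + t 4)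
      (E₂ := editDist ((S.take (s + t 3)).drop (s + t 2)) (ones P.γ₁))
      (E₃ := editDist ((S.take (s + t 4)).drop (s + t 3)) (zeros P.γ₁)) hm2 hm3 ⟨hB₂l', hB₂l⟩
      ⟨by omega, by omega⟩
    have D5 := P.dist_mid_right_le xi hxi (T₅ := s + t 5) (T₆ := s + t 6) (T₇ := s + t 7)
      (E₅ := editDist ((S.take (s + t 6)).drop (s + t 5)) (zeros P.γ₁))
      (E₆ := editDist ((S.take (s + t 7)).drop (s + t 6)) (ones P.γ₁)) hm5 hm6 ⟨hB₆l', hB₆l⟩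
      ⟨by omega, by omega⟩
    have D9 := P.dist_right_le xi hxi (T₈ := s + t 8) (T₉ := e)
      (E := editDist ((S.take e).drop (s + t 8)) (ones P.γ₁)) hm8 ⟨hB₈l', hB₈l⟩ ⟨by omega, by omega⟩
    rw [← hS] at D0 D4 D5 D9
    have d0 := D0 hE0 hE0'
    have d4 := D4 hE2 hE2' hE3 hE3'
    have d5 := D5 hE6 hE6' hE5 hE5'
    have d9 := D9 hE8 hE8'
    clear D0 D4 D5 D9 hE0 hE0' hE2 hE2' hE3 hE3' hE5 hE5' hE6 hE6' hE8 hE8' hB₂l hB₂l' hB₂r hB₂r'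
      hB₆l hB₆l' hB₆r hB₆r' hB₀r hB₀r' hB₈l hB₈l'
    refine ⟨by omega, by omega, by omega⟩

end Params

end BKGadget

end Literature.Computability.FineGrained
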